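import Literature.Analysis.FunctionSpaces.FlatTorus
import HarnessLib

/-!
# FunctionalMining — the half-root map `w ↦ w/√‖w‖` is `½`-Hölder, and the mean of `‖u‖u` is
# controlled by its oscillation when `∫ u = 0` (tools for the explicit nonlinear Poincaré inequality)

search for candidate a priori estimates; no regularity claim. Cell `pub-nsfunc`, prove seat
(gen 8). Static, elementary facts; nothing here concerns Navier–Stokes solutions. Companion of
`VelocityL4NonlinearPoincare` (the inequality `∫|u|⁴ ≤ C∫|u|²|∇u|²` for zero-mean fields, the
coercive step of the `L⁴` velocity-moment law, K0 row `EV.s=4|T_LD|G1`).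

* `norm_halfRoot_sub_le` — for the half-root map `g(w) = ‖w‖^{-1/2} w` of a real inner product
  space (the inverse of `u ↦ ‖u‖u`, `halfRoot_norm_smul`): `‖g a − g b‖ ≤ 3 √‖a − b‖`.
* `integral_sqrt_le`, `integral_le_sqrt_integral_sq` — two Jensen steps on the probability space
  `T^d` (`∫√f ≤ √∫f`, `∫f ≤ √∫f²`), proved from `√f ≤ f/(2t) + t/2`.
* `norm_sq_integral_le` — **mean control**: for a continuous zero-mean field `u` on `T^d`,
  `W := ‖u‖u`, `c := ∫W`: `‖c‖² ≤ 81 ∫‖W − c‖²` (from `g(c) = ∫(g c − g(W))`, Hölder, Jensen).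
[ours; elementary]
-/

noncomputable section

open MeasureTheory Finset
open scoped InnerProductSpace RealInnerProductSpace

namespace Summit.NavierStokesRegularity.FunctionalMining

open Literature.Analysis.FunctionSpaces Literature.Analysis.FunctionSpaces.Torus

namespace VelocityL4


/-! ## 1. The half-root map `g(w) = w/√‖w‖` and its `½`-Hölder bound -/

section HalfRoot

variable {E : Type*} [NormedAddCommGroup E] [InnerProductSpace ℝ E]

omit [InnerProductSpace ℝ E] in
/-- `‖g(w)‖ = √‖w‖`. [ours] -/
theorem norm_halfRoot [NormedSpace ℝ E] (w : E) :
    ‖(Real.sqrt ‖w‖)⁻¹ • w‖ = Real.sqrt ‖w‖ := by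
  by_cases hw : w = 0
  · simp [hw]
  · have hn : 0 < ‖w‖ := norm_pos_iff.2 hw
    have hs : 0 < Real.sqrt ‖w‖ := Real.sqrt_pos.2 hn
    rw [norm_smul, norm_inv, Real.norm_of_nonneg hs.le]
    have : Real.sqrt ‖w‖ * Real.sqrt ‖w‖ = ‖w‖ := Real.mul_self_sqrt hn.le
    field_simp
    linarith [this]

/-- `g(‖u‖ u) = u`. [ours] -/
theorem halfRoot_norm_smul (u : E) : (Real.sqrt ‖‖u‖ • u‖)⁻¹ • (‖u‖ • u) = u := by
  by_cases hu : u = 0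
  · simp [hu]
  · have hn : 0 < ‖u‖ := norm_pos_iff.2 hu
    rw [norm_smul, Real.norm_of_nonneg hn.le, ← sq, Real.sqrt_sq hn.le, smul_smul,
      inv_mul_cancel₀ hn.ne', one_smul]

/-- `|√A − √B| ≤ √|A − B|` for `A, B ≥ 0` (private copy; the same statement is
`Literature.Computability.Cryptography.abs_sqrt_sub_sqrt_le`, not imported here). [folklore] -/
private theorem abs_sqrt_sub_sqrt_le {A B : ℝ} (hA : 0 ≤ A) (hB : 0 ≤ B) :
    |Real.sqrt A - Real.sqrt B| ≤ Real.sqrt |A - B| := by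
  -- symmetric claim: `√A ≤ √B + √|A−B|`
  have key : ∀ {A B : ℝ}, 0 ≤ A → 0 ≤ B → Real.sqrt A ≤ Real.sqrt B + Real.sqrt |A - B| := by
    intro A B hA hB
    have h1 : A ≤ B + |A - B| := by
      have := le_abs_self (A - B); linarith
    calc Real.sqrt A ≤ Real.sqrt (B + |A - B|) := Real.sqrt_le_sqrt h1
      _ ≤ Real.sqrt B + Real.sqrt |A - B| := by
          rw [Real.sqrt_le_left (by positivity)]
          have hb := Real.sq_sqrt hB
          have hc := Real.sq_sqrt (abs_nonneg (A - B))
          nlinarith [Real.sqrt_nonneg B, Real.sqrt_nonneg |A - B|]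
  rw [abs_sub_le_iff]
  constructor
  · have := key hA hB; linarith
  · have := key hB hA; rw [abs_sub_comm] at this; linarith

/-- For non-zero `a, b`: the unit vectors satisfy `‖a/‖a‖ − b/‖b‖‖ ≤ 2‖a − b‖/‖b‖`. [folklore] -/
theorem norm_unit_sub_unit_le {a b : E} (ha : a ≠ 0) (hb : b ≠ 0) :
    ‖(‖a‖)⁻¹ • a - (‖b‖)⁻¹ • b‖ ≤ 2 * ‖a - b‖ / ‖b‖ := by
  have hA : 0 < ‖a‖ := norm_pos_iff.2 ha
  have hB : 0 < ‖b‖ := norm_pos_iff.2 hb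
  -- `â − b̂ = ‖b‖⁻¹ (a − b) + (‖a‖⁻¹ − ‖b‖⁻¹) a`
  have hsplit : (‖a‖)⁻¹ • a - (‖b‖)⁻¹ • b =
      (‖b‖)⁻¹ • (a - b) + ((‖a‖)⁻¹ - (‖b‖)⁻¹) • a := by
    rw [smul_sub, sub_smul]; abel
  rw [hsplit]
  have h1 : ‖(‖b‖)⁻¹ • (a - b)‖ = ‖a - b‖ / ‖b‖ := by
    rw [norm_smul, norm_inv, norm_norm, div_eq_inv_mul]
  have h2 : ‖((‖a‖)⁻¹ - (‖b‖)⁻¹) • a‖ ≤ ‖a - b‖ / ‖b‖ := by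
    rw [norm_smul, Real.norm_eq_abs]
    have e : ((‖a‖)⁻¹ - (‖b‖)⁻¹) * ‖a‖ = (‖b‖ - ‖a‖) / ‖b‖ := by
      field_simp
    have : |(‖a‖)⁻¹ - (‖b‖)⁻¹| * ‖a‖ = |‖b‖ - ‖a‖| / ‖b‖ := by
      rw [← abs_of_pos hA, ← abs_mul, abs_of_pos hA, e, abs_div, abs_of_pos hB]
    rw [this]
    exact div_le_div_of_nonneg_right ((abs_norm_sub_norm_le b a).trans (by rw [norm_sub_rev]))
      hB.le
  calc ‖(‖b‖)⁻¹ • (a - b) + ((‖a‖)⁻¹ - (‖b‖)⁻¹) • a‖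
      ≤ ‖(‖b‖)⁻¹ • (a - b)‖ + ‖((‖a‖)⁻¹ - (‖b‖)⁻¹) • a‖ := norm_add_le _ _
    _ ≤ ‖a - b‖ / ‖b‖ + ‖a - b‖ / ‖b‖ := by rw [h1]; exact add_le_add le_rfl h2
    _ = 2 * ‖a - b‖ / ‖b‖ := by ring

/-- **The half-root map is `½`-Hölder**: `‖g a − g b‖ ≤ 3 √‖a − b‖`. [ours; elementary] -/
theorem norm_halfRoot_sub_le (a b : E) :
    ‖(Real.sqrt ‖a‖)⁻¹ • a - (Real.sqrt ‖b‖)⁻¹ • b‖ ≤ 3 * Real.sqrt ‖a - b‖ := by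
  have h0 : 0 ≤ Real.sqrt ‖a - b‖ := Real.sqrt_nonneg _
  by_cases hb : b = 0
  · subst hb
    rw [smul_zero, sub_zero, sub_zero, norm_halfRoot]
    linarith [Real.sqrt_nonneg ‖a‖]
  by_cases ha : a = 0
  · subst ha
    rw [smul_zero, zero_sub, norm_neg, norm_halfRoot, zero_sub, norm_neg]
    linarith [Real.sqrt_nonneg ‖b‖]
  have hA : 0 < ‖a‖ := norm_pos_iff.2 ha
  have hB : 0 < ‖b‖ := norm_pos_iff.2 hb
  have hsA : 0 < Real.sqrt ‖a‖ := Real.sqrt_pos.2 hA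
  have hsB : 0 < Real.sqrt ‖b‖ := Real.sqrt_pos.2 hB
  -- `g a = √‖a‖ • â`, `g b = √‖b‖ • b̂`
  have ga : (Real.sqrt ‖a‖)⁻¹ • a = Real.sqrt ‖a‖ • ((‖a‖)⁻¹ • a) := by
    rw [smul_smul]; congr 1
    field_simp
    rw [Real.sq_sqrt hA.le]
  have gb : (Real.sqrt ‖b‖)⁻¹ • b = Real.sqrt ‖b‖ • ((‖b‖)⁻¹ • b) := by
    rw [smul_smul]; congr 1
    field_simp
    rw [Real.sq_sqrt hB.le]
  rw [ga, gb]
  -- split: `(√A − √B) â + √B (â − b̂)`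
  have hsplit : Real.sqrt ‖a‖ • ((‖a‖)⁻¹ • a) - Real.sqrt ‖b‖ • ((‖b‖)⁻¹ • b) =
      (Real.sqrt ‖a‖ - Real.sqrt ‖b‖) • ((‖a‖)⁻¹ • a) +
        Real.sqrt ‖b‖ • ((‖a‖)⁻¹ • a - (‖b‖)⁻¹ • b) := by
    rw [sub_smul, smul_sub]; abel
  rw [hsplit]
  have hunit : ‖(‖a‖)⁻¹ • a‖ = 1 := by
    rw [norm_smul, norm_inv, norm_norm, inv_mul_cancel₀ hA.ne']
  -- first piece
  have h1 : ‖(Real.sqrt ‖a‖ - Real.sqrt ‖b‖) • ((‖a‖)⁻¹ • a)‖ ≤ Real.sqrt ‖a - b‖ := by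
    rw [norm_smul, hunit, mul_one, Real.norm_eq_abs]
    calc |Real.sqrt ‖a‖ - Real.sqrt ‖b‖| ≤ Real.sqrt |‖a‖ - ‖b‖| :=
          abs_sqrt_sub_sqrt_le (norm_nonneg _) (norm_nonneg _)
      _ ≤ Real.sqrt ‖a - b‖ := Real.sqrt_le_sqrt (abs_norm_sub_norm_le a b)
  -- second piece
  have h2 : ‖Real.sqrt ‖b‖ • ((‖a‖)⁻¹ • a - (‖b‖)⁻¹ • b)‖ ≤ 2 * Real.sqrt ‖a - b‖ := by
    rw [norm_smul, Real.norm_of_nonneg hsB.le]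
    rcases le_or_gt ‖a - b‖ ‖b‖ with hle | hgt
    · -- `√B · 2‖a−b‖/B = 2‖a−b‖/√B ≤ 2√‖a−b‖`
      have hu := norm_unit_sub_unit_le ha hb
      calc Real.sqrt ‖b‖ * ‖(‖a‖)⁻¹ • a - (‖b‖)⁻¹ • b‖
          ≤ Real.sqrt ‖b‖ * (2 * ‖a - b‖ / ‖b‖) := mul_le_mul_of_nonneg_left hu hsB.le
        _ = 2 * (‖a - b‖ / Real.sqrt ‖b‖) := by
            have : ‖b‖ = Real.sqrt ‖b‖ * Real.sqrt ‖b‖ := (Real.mul_self_sqrt hB.le).symm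
            field_simp
            nlinarith [this]
        _ ≤ 2 * Real.sqrt ‖a - b‖ := by
            gcongr
            rw [div_le_iff₀ hsB]
            calc ‖a - b‖ = Real.sqrt ‖a - b‖ * Real.sqrt ‖a - b‖ :=
                  (Real.mul_self_sqrt (norm_nonneg _)).symm
              _ ≤ Real.sqrt ‖a - b‖ * Real.sqrt ‖b‖ :=
                  mul_le_mul_of_nonneg_left (Real.sqrt_le_sqrt hle) h0
    · -- `‖â − b̂‖ ≤ 2` and `√B ≤ √‖a−b‖`
      have hu : ‖(‖a‖)⁻¹ • a - (‖b‖)⁻¹ • b‖ ≤ 2 := by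
        have hunit' : ‖(‖b‖)⁻¹ • b‖ = 1 := by
          rw [norm_smul, norm_inv, norm_norm, inv_mul_cancel₀ hB.ne']
        calc ‖(‖a‖)⁻¹ • a - (‖b‖)⁻¹ • b‖ ≤ ‖(‖a‖)⁻¹ • a‖ + ‖(‖b‖)⁻¹ • b‖ := norm_sub_le _ _
          _ = 2 := by rw [hunit, hunit']; norm_num
      calc Real.sqrt ‖b‖ * ‖(‖a‖)⁻¹ • a - (‖b‖)⁻¹ • b‖ ≤ Real.sqrt ‖a - b‖ * 2 :=
            mul_le_mul (Real.sqrt_le_sqrt hgt.le) hu (norm_nonneg _) h0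
        _ = 2 * Real.sqrt ‖a - b‖ := by ring
  calc ‖(Real.sqrt ‖a‖ - Real.sqrt ‖b‖) • ((‖a‖)⁻¹ • a) +
        Real.sqrt ‖b‖ • ((‖a‖)⁻¹ • a - (‖b‖)⁻¹ • b)‖
      ≤ ‖(Real.sqrt ‖a‖ - Real.sqrt ‖b‖) • ((‖a‖)⁻¹ • a)‖ +
        ‖Real.sqrt ‖b‖ • ((‖a‖)⁻¹ • a - (‖b‖)⁻¹ • b)‖ := norm_add_le _ _
    _ ≤ Real.sqrt ‖a - b‖ + 2 * Real.sqrt ‖a - b‖ := add_le_add h1 h2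
    _ = 3 * Real.sqrt ‖a - b‖ := by ring

end HalfRoot

/-! ## 2. Two elementary Jensen steps on the probability space `T^d` -/

section Jensen

variable {d : Type*} [Fintype d]

/-- `∫ √f ≤ √(∫ f)` for a continuous `f ≥ 0` on `T^d` (from `√f ≤ f/(2t) + t/2`). [folklore] -/
theorem integral_sqrt_le {f : UnitAddTorus d → ℝ} (hf : Continuous f) (h0 : ∀ x, 0 ≤ f x) :
    ∫ x, Real.sqrt (f x) ≤ Real.sqrt (∫ x, f x) := by
  have hI0 : 0 ≤ ∫ x, f x := integral_nonneg h0
  have hint : Integrable f volume := hf.integrable_unitAddTorus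
  have hsint : Integrable (fun x => Real.sqrt (f x)) volume :=
    (Real.continuous_sqrt.comp hf).integrable_unitAddTorus
  -- for every `t > 0`: `∫ √f ≤ (∫ f)/(2t) + t/2`
  have step : ∀ t : ℝ, 0 < t → ∫ x, Real.sqrt (f x) ≤ (∫ x, f x) / (2 * t) + t / 2 := by
    intro t ht
    have hpt : ∀ x, Real.sqrt (f x) ≤ f x / (2 * t) + t / 2 := by
      intro x
      have hs := Real.sq_sqrt (h0 x)
      have : 0 ≤ (Real.sqrt (f x) - t) ^ 2 := sq_nonneg _
      rw [div_add_div _ _ (by positivity) (by norm_num), le_div_iff₀ (by positivity)]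
      nlinarith
    calc ∫ x, Real.sqrt (f x) ≤ ∫ x, (f x / (2 * t) + t / 2) :=
          integral_mono hsint ((hint.div_const _).add (integrable_const _)) hpt
      _ = (∫ x, f x) / (2 * t) + t / 2 := by
          rw [integral_add (hint.div_const _) (integrable_const _), integral_div, integral_const]
          simp
  refine le_of_forall_pos_lt_add fun η hη => ?_
  have h := step (Real.sqrt (∫ x, f x) + η) (by positivity)
  have hs := Real.sq_sqrt hI0
  have h1 : (∫ x, f x) / (2 * (Real.sqrt (∫ x, f x) + η)) ≤ Real.sqrt (∫ x, f x) / 2 := by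
    rw [div_le_div_iff₀ (by positivity) (by norm_num)]
    nlinarith [Real.sqrt_nonneg (∫ x, f x)]
  linarith

/-- `∫ f ≤ √(∫ f²)` for a continuous `f` on `T^d` (from `f ≤ f²/(2t) + t/2`). [folklore] -/
theorem integral_le_sqrt_integral_sq {f : UnitAddTorus d → ℝ} (hf : Continuous f) :
    ∫ x, f x ≤ Real.sqrt (∫ x, f x ^ 2) := by
  have hI0 : 0 ≤ ∫ x, f x ^ 2 := integral_nonneg fun x => sq_nonneg _
  have hint : Integrable f volume := hf.integrable_unitAddTorus
  have hint2 : Integrable (fun x => f x ^ 2) volume := (hf.pow 2).integrable_unitAddTorus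
  have step : ∀ t : ℝ, 0 < t → ∫ x, f x ≤ (∫ x, f x ^ 2) / (2 * t) + t / 2 := by
    intro t ht
    have hpt : ∀ x, f x ≤ f x ^ 2 / (2 * t) + t / 2 := by
      intro x
      have : 0 ≤ (f x - t) ^ 2 := sq_nonneg _
      rw [div_add_div _ _ (by positivity) (by norm_num), le_div_iff₀ (by positivity)]
      nlinarith
    calc ∫ x, f x ≤ ∫ x, (f x ^ 2 / (2 * t) + t / 2) :=
          integral_mono hint ((hint2.div_const _).add (integrable_const _)) hpt
      _ = (∫ x, f x ^ 2) / (2 * t) + t / 2 := by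
          rw [integral_add (hint2.div_const _) (integrable_const _), integral_div, integral_const]
          simp
  refine le_of_forall_pos_lt_add fun η hη => ?_
  have h := step (Real.sqrt (∫ x, f x ^ 2) + η) (by positivity)
  have hs := Real.sq_sqrt hI0
  have h1 : (∫ x, f x ^ 2) / (2 * (Real.sqrt (∫ x, f x ^ 2) + η)) ≤ Real.sqrt (∫ x, f x ^ 2) / 2 := by
    rw [div_le_div_iff₀ (by positivity) (by norm_num)]
    nlinarith [Real.sqrt_nonneg (∫ x, f x ^ 2)]
  linarith

end Jensen

/-! ## 3. The mean of `W = ‖u‖u` is controlled by its oscillation when `∫ u = 0` -/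

section Mean

variable {d : Type*} [Fintype d]

/-- **Mean control.** For a continuous zero-mean field `u` on `T^d`, `W := ‖u‖u` and `c := ∫ W`:
`‖c‖² ≤ 81 ∫ ‖W − c‖²` (from `g(c) = ∫ (g c − g(W))`, the `½`-Hölder bound of `g` and Jensen).
[ours; elementary] -/
theorem norm_sq_integral_le {u : UnitAddTorus d → EuclideanSpace ℝ d} (hu : Continuous u)
    (h0 : ∫ x, u x = 0) :
    ‖∫ x, ‖u x‖ • u x‖ ^ 2 ≤ 81 * ∫ x, ‖‖u x‖ • u x - ∫ y, ‖u y‖ • u y‖ ^ 2 := by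
  set W : UnitAddTorus d → EuclideanSpace ℝ d := fun x => ‖u x‖ • u x with hW
  set c : EuclideanSpace ℝ d := ∫ x, W x with hc
  have hWc : Continuous W := hu.norm.smul hu
  have hWi : Integrable W volume := hWc.integrable_unitAddTorus
  -- the half-root map `g(w) = w/√‖w‖` and `g c = ∫ (g c − g (W x))`
  set g : EuclideanSpace ℝ d → EuclideanSpace ℝ d := fun w => (Real.sqrt ‖w‖)⁻¹ • w with hgdef
  have hg : g c = ∫ x, (g c - g (W x)) := by
    have e : (fun x => g c - g (W x)) = fun x => g c - u x := by
      funext x; rw [hW, hgdef]; simp only; rw [halfRoot_norm_smul]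
    rw [e, integral_sub (integrable_const _) hu.integrable_unitAddTorus, h0, sub_zero,
      integral_const]
    simp
  -- `√‖c‖ ≤ 3 ∫ √‖W − c‖`
  have hdc : Continuous fun x => ‖W x - c‖ := (hWc.sub continuous_const).norm
  have h1 : Real.sqrt ‖c‖ ≤ 3 * ∫ x, Real.sqrt ‖W x - c‖ := by
    have hn : ‖g c‖ = Real.sqrt ‖c‖ := norm_halfRoot c
    rw [← hn, hg]
    calc ‖∫ x, (g c - g (W x))‖ ≤ ∫ x, ‖g c - g (W x)‖ :=
          norm_integral_le_integral_norm _
      _ ≤ ∫ x, 3 * Real.sqrt ‖W x - c‖ := by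
          refine integral_mono_of_nonneg (ae_of_all _ fun x => norm_nonneg _)
            (((Real.continuous_sqrt.comp hdc).const_mul 3).integrable_unitAddTorus)
            (ae_of_all _ fun x => ?_)
          have := norm_halfRoot_sub_le c (W x)
          rwa [← norm_sub_rev (W x) c] at this
      _ = 3 * ∫ x, Real.sqrt ‖W x - c‖ := integral_const_mul _ _
  -- Jensen twice: `∫ √‖W−c‖ ≤ (∫‖W−c‖²)^{1/4}`
  have h2 : ∫ x, Real.sqrt ‖W x - c‖ ≤ Real.sqrt (Real.sqrt (∫ x, ‖W x - c‖ ^ 2)) :=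
    (integral_sqrt_le hdc fun x => norm_nonneg _).trans
      (Real.sqrt_le_sqrt (integral_le_sqrt_integral_sq hdc))
  -- square twice
  have hV0 : 0 ≤ ∫ x, ‖W x - c‖ ^ 2 := integral_nonneg fun x => sq_nonneg _
  have h3 : Real.sqrt ‖c‖ ≤ 3 * Real.sqrt (Real.sqrt (∫ x, ‖W x - c‖ ^ 2)) := by linarith
  have h4 : ‖c‖ ≤ 9 * Real.sqrt (∫ x, ‖W x - c‖ ^ 2) := by
    have e1 := Real.sq_sqrt (norm_nonneg c)
    have e2 := Real.sq_sqrt (Real.sqrt_nonneg (∫ x, ‖W x - c‖ ^ 2))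
    nlinarith [Real.sqrt_nonneg ‖c‖, Real.sqrt_nonneg (Real.sqrt (∫ x, ‖W x - c‖ ^ 2))]
  have e3 := Real.sq_sqrt hV0
  nlinarith [norm_nonneg c, Real.sqrt_nonneg (∫ x, ‖W x - c‖ ^ 2)]

end Mean

end VelocityL4

end Summit.NavierStokesRegularity.FunctionalMining
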